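import Literature.MathematicalPhysics.QuantumFieldTheory.Balaban1983to89.B15Prop1FlatCoerciveSplit
import Literature.MathematicalPhysics.QuantumFieldTheory.Balaban1983to89.B15Prop1LinearisedKernelLevelZeroB

/-!
# `Balaban1983to89.B15Prop1FlatCoerciveSplit` — [Balaban1984PropagatorsII] = «[B6]», Lemma 2.4 (2.128) p. 245, (2.153) p. 249; [Balaban1985Variational] = «[15]», (44)–(48) p. 285, — **BOND-DATUM EDITION** (`…B15Prop1FlatCoerciveSplitB`, USED DECLARATIONS ONLY): the print-datum ([Balaban1984PropagatorsII] (2.3)) twins of the declarations of `B15Prop1FlatCoerciveSplit` that N12's junction of record v14ᴸ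
uses with a datum-bearing statement (`flatCoercive_of_flatAveragedCoercive_of_flatAverageBound_sliceDatum`) — class (γ) of dag-n12-c's census-by-declaration v2 (bus [DAGN12C-G35], 2026-08-30).  GENERATOR (block-extracted from the
parent's tree bytes by HOME `lean/g35/gen/gen_blocks.py`): namespace `…B`, SAME names, `DetSet ↦ BDetSet` (F0a), `AgreeOn ↦ AgreeOnB`, `IsMinimizer ↦ IsMinimizerB`, `bondsOf (𝐁 j) ↦ 𝔅 j`, `constrCard ∕
constrEnum ∕ ConstrSet ∕ msChart ↦ …B` (lane `Node00/MultiScaleFibreChartB`), `IsCritOnFibre ∕ IsFibreChartNear ↦ …B`; proofs VERBATIM; the parent's other (datum-free) declarations REUSED by `open`.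

statement-level skeleton of published theorems with citation tags; proofs where landed; nothing here is a claim about
the Yang–Mills mass gap

Cell `pub-ymgap` (HUMAN RULINGS D-0062 ∕ D-0149), lane `pub-ymgap-dag-n12-c` g35 (R134 seat (a), N12 = [B15], s1, lane owner); `--kind proof --supports` K1⁹ `stmt-QuantumFields-27364`; count-neutral.
THEOREMS ONLY (0 `def`, 0 `instance`, 0 `sorry`).  HONESTY GUARD (director-ym №338 (5)): PURELY ADDITIVE — the parent stays landed and true on its own text; nothing in it is edited; no displayed
premise of any consumer is deleted or weakened; every hypothesis stays a hypothesis.  Nothing of Bałaban's analysis asserted; N12 NOT discharged; K0⁷ ∕ K1⁹ NOT closed; one finite 𝕋⁴ programme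
at fixed ε — nothing continuum ∕ ℝ⁴ ∕ OS; the Yang–Mills mass gap (Clay) is NOT proved by any of this.

PARENT's DOCSTRING (mathematics and citations; read `𝐁` as the bond datum `𝔅`):
# `Balaban1983to89.B15Prop1FlatCoerciveSplit` — [Balaban1984PropagatorsII] = «[B6]», Lemma 2.4 (2.128) p. 245, (2.153) p. 249; [Balaban1985Variational] = «[15]», (44)–(48) p. 285,
# (82)–(83) p. 290; [Balaban1985Averaging] = «[4]», (122)–(126) p. 36, Prop. 4 (134)–(135) pp. 37–39; [Balaban1985BackgroundPropagators] = «[B9]», (3.78)–(3.81) p. 406; [Balaban1989LargeFieldII]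
# (1.7)–(1.9) p. 358:
# THE FLAT COERCIVITY LETTER (P) OF THE (β)-SPLIT ⟸ A FLAT «LEMMA 2.4»-SHAPED LETTER WITH ITS AVERAGING TERM + A LETTER ON THE FLAT AVERAGES OF A KERNEL FIELD —
# and NON-VACUITY of the second letter at the flat base

Honest framing: statement-level skeleton of published theorems with citation tags; proofs where landed; nothing here is a claim about the
Yang–Mills mass gap.  Cell `pub-ymgap`, HUMAN RULING D-0062 (Track A), seat `pub-ymgap-dag-n12-c` g25 (lane owner N12 = [B15], strategy s1); count-neutral; N12 NOT discharged;
finite 𝕋⁴ at fixed ε; nothing continuum ∕ OS ∕ mass-gap ∕ Clay.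

WHY (lane memo `N12-UNIFORMITY-SPEC.md` §8).  The (β)-split `B15Prop1RealCoerciveFromNearFlatExpansion` (p710229) displays the FLAT COERCIVITY letter (P): for every real slice field `p` in
the kernel of the linearised constraint AT THE BACKGROUND `U₀`, `cP·Σ_b‖p_b‖² ≤ d²∕ds² A(exp(sp)·1)|₀`.  Print's flat inequality is [B6] Lemma 2.4 (2.128) — `(1∕12d²)L^{−d−1}‖B‖² ≤
L^{d−2}Σ_c|(Q₁B)(c)|² + Σ_p|(∂₁B)(p)|²` in the block tree gauge — which carries the FLAT LINEAR averages `Q₁B` on its right ((2.153): on `{QB = 0}` the term drops).  A field in the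
kernel at `U₀` is killed by the linearised NONLINEAR averages `Q_j(U₀)` ([15] (44)), not by `Q_j(1)`; the difference is the BACKGROUND DEPENDENCE OF THE LINEARISED AVERAGING — printed in
[4] Sect. D (124)–(126) p. 36 («The first term … is the main term in this linear form, and it resembles the definition of the averaging operation Q in [2]. The remaining terms … can be estimated by
O(L²α₀) and the terms can be estimated by O(1)L²α₀L|A|»; Prop. 4 (134)–(135) for the `j`-fold average) and restated in [B9] Sect. C p. 406 (3.79)–(3.81) («Q(exp iBV) = Q(V) + F₂(B), and
|F₂(B)B′| ≦ O(1) sup|B| Q″|B′|», «Q_j(U′U) = Q_j(U) + F_{2,j}(A)», «|F_{2,j}(A)A′| ≦ O(1)α₁Q″_j|A′| on Λ_j … with a constant O(1) depending on d and L only»); [15] Sect. C itself prints no such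
display (p. 287 l. 25–30: prose analyticity in `U₀` only) — lit-balaban ME #43, 2026-08-29.  THIS FILE splits (P) accordingly into two print-shaped letters: (P♭Q) a FLAT «Lemma 2.4»-shaped coercivity WITH the averaging term, on the WHOLE real slice
(no kernel condition; depends on the determining set and the slice only — inhabitable per instance from dag-n12-w3's flat (β)♭ `N12ForestSlice` by compactness, or from pv09's
`B6Lemma24Torus.lemma24_torus` quantitatively), and (L) a bound on the FLAT linearised averages `Q_j(1)p̂` of a `U₀`-kernel field — THE ROW'S FIRST MISSING ESTIMATE in NODE 00's `dIterL`
currency; and it certifies that (L) is NOT VACUOUS: at the flat base `U₀ = 1` it holds with constant `0` (the kernel there IS `{Q_j(1)p̂ = 0}`, by `B15Prop1LinearisedKernelLevelZero`).  AT THE RECORD (L) is to be produced from [4] (124)–(126) ∕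
[B9] (3.79)–(3.81) in the block axial gauge of the tower proxies (pointwise, `O(1)L²α₀`, d- and L-dependent constants, uniform in `j`) — NODE 00's `dIterL` one-step formula `dAvgL_apply` vs the
flat `dAvgL_one_apply_of_skew`; not in this file.

CONTENTS (theorems only; no `def`, no `instance`, no `sorry`).  §1 ★★ `flatCoercive_of_flatAveragedCoercive_of_flatAverageBound` ((P) ⟸ (P♭Q) + (L), `cP := c♭ − CL`).
§2 `iter_blockAvg_flat_eq_one` (`Ū^j(1) = 1`), `guardOn_one_blockAvg` (the flat configuration is on every per-tower guard), ★ `dIterL_one_apply_eq_zero_of_fderiv_sliceDatum_eq_zero_one` (at `U₀ = 1` a real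
kernel field has ALL flat linearised averages zero — FILE 3's §2 at the flat base), ★★ `flatAverageBound_one` ((L) holds at `U₀ = 1` with `CL = 0`: non-vacuity).
HONEST SCOPE: algebra and bookkeeping; (P♭Q) and (L) are DISPLAYED letters (not proved here except (L) at the flat base); nothing of Bałaban's asserted; count-neutral; N12 NOT discharged;
the YM mass gap (Clay) is NOT proved by any of this — R4 closes only the conditional finite-𝕋⁴ rung `BalabanLadder.UV`.
-/


noncomputable section

namespace Literature.MathematicalPhysics.QuantumFieldTheory.Balaban1983to89.B15Prop1FlatCoerciveSplitB

open B15Prop1FlatCoerciveSplit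


open Set Metric Filter
open scoped Topology BigOperators
open Literature.MathematicalPhysics.QuantumFieldTheory.Balaban1983to89.Node00 (SU coeField coeField_apply SmallBelow ConstrSetB constrCardB constrEnumB dIterL)
open T4AdjointCovarianceUnitary (lieSU)
open B15AveragingHolomorphic (iterMh)
open B15SU2ChartHolomorphic (genE expMulC logCoordC)
open B15Prop1RightInverseFromLinearisedAveraging (hasDerivAt_coe_avgFamily_expMul_smul)
open B15Prop1LinearisedKernelLevelZeroB (velocity_eq_zero_of_fderiv_sliceDatum_eq_zero_of_guardOn)
open B15Prop1AnalyticExtClause (cplxVec)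
open B15Prop1ChartCalculusSU2 (E3)
open B15Prop1ChartSU2 (su2Chart)
open B16Sect1Backgrounds (expMul)
open ExpMeanLog (expMeanLogSU)
open BlockAveraging (blockAvg)
open T4CubeChartGnomonic (SU2)
open T4Continuum B15DeterminingSets B15DeterminingSetsB GaugeField
open scoped Matrix.Norms.L2Operator

variable {P : Params}



section

/-- The same in the binder shape of the (β)-split's (P) row (`Ker p := DΦ₀(0)⟨cplxVec p, _⟩ = 0` for slice datum coordinates `Φ₀ : S → F`).
[cite: Balaban1984PropagatorsII, Lemma 2.4 (2.128) p.245; Balaban1985Variational, (82)–(83) p.290; Balaban1989LargeFieldII, (1.9) p.358] -/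
theorem flatCoercive_of_flatAveragedCoercive_of_flatAverageBound_sliceDatum (𝔅 : BDetSet P) (k : ℕ) (S : Submodule ℂ (VecField P 0 (EuclideanSpace ℂ (Fin 3))))
    {F : Type*} [NormedAddCommGroup F] [NormedSpace ℂ F] (Φ₀ : S → F) {cflat CL : ℝ}
    (hPQ : ∀ p : VecField P 0 E3, cplxVec p ∈ S →
      cflat * ∑ b : PBond P 0, ‖p b‖ ^ 2 ≤ deriv (deriv fun s : ℝ => wilsonAction4 (expMul su2Chart (s • p) (1 : GaugeField P 0 SU2))) 0 +
        ∑ i : Fin (constrCardB 𝔅 k), ‖dIterL ((constrEnumB 𝔅 k).symm i).1 (coeField (1 : GaugeField P 0 SU2))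
          (fun b => ∑ a : Fin 3, ((p b a : ℝ) : ℂ) • genE a) ((constrEnumB 𝔅 k).symm i).2.1‖ ^ 2)
    (hL : ∀ (p : VecField P 0 E3) (hp : cplxVec p ∈ S), fderiv ℂ Φ₀ 0 ⟨cplxVec p, hp⟩ = 0 →
      ∑ i : Fin (constrCardB 𝔅 k), ‖dIterL ((constrEnumB 𝔅 k).symm i).1 (coeField (1 : GaugeField P 0 SU2))
          (fun b => ∑ a : Fin 3, ((p b a : ℝ) : ℂ) • genE a) ((constrEnumB 𝔅 k).symm i).2.1‖ ^ 2 ≤ CL * ∑ b : PBond P 0, ‖p b‖ ^ 2) :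
    ∀ (p : VecField P 0 E3) (hp : cplxVec p ∈ S), fderiv ℂ Φ₀ 0 ⟨cplxVec p, hp⟩ = 0 →
      (cflat - CL) * ∑ b : PBond P 0, ‖p b‖ ^ 2 ≤ deriv (deriv fun s : ℝ => wilsonAction4 (expMul su2Chart (s • p) (1 : GaugeField P 0 SU2))) 0 := by
  intro p hp hker
  have h1 := hPQ p hp
  have h2 := hL p hp hker
  rw [sub_mul]
  linarith

end

end Literature.MathematicalPhysics.QuantumFieldTheory.Balaban1983to89.B15Prop1FlatCoerciveSplitB

end
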